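import Summits.KontsevichZagierPeriods.Zeta5Search.TwoTaleLineBoundBlocks

/-!
# Line-bound bricks: the primitive is Lipschitz in the endpoint

HONEST FRAMING: systematic search; no irrationality claim unless certified.

Cell pub-zeta5, T3 service (P1 g9) for E5 (`families/denom/P15KERNEL.md` §6.1).  The block endpoints on the line
`x = ⌊ξn⌋ + ½` are `nVᵢ + O(1)`, not exactly `nVᵢ*`; since `∂/∂V prim η V = halfLog η V = ½log(V²+η²)`, the primitive is
Lipschitz in `V` on any segment avoiding `0`:
* `abs_halfLog_le : m ≤ |W| → |W| ≤ M → |halfLog η W| ≤ |log m| + ½log(M²+η²)` (`0 < m`, `1 ≤ M`);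
* **`abs_prim_sub_prim_le`**: if every point of the segment `[V, V']` has `m ≤ |W| ≤ M`, then
  `|prim η V' − prim η V| ≤ (|log m| + ½log(M²+η²)) · |V' − V|`.
With `prim_scale` this turns the `O(1)` endpoint offsets into an additive `O(log(M²+η²))` (un-scaled by `n`) error.
-/

noncomputable section

open Real Set

namespace Summit.KontsevichZagierPeriods.Zeta5Search.TwoTaleLineBound

/-- `|½log(W²+η²)| ≤ |log m| + ½log(M²+η²)` for `0 < m ≤ |W| ≤ M`, `1 ≤ M`. -/
theorem abs_halfLog_le {η m M W : ℝ} (hm : 0 < m) (hM : 1 ≤ M) (h1 : m ≤ |W|) (h2 : |W| ≤ M) :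
    |halfLog η W| ≤ |Real.log m| + Real.log (M ^ 2 + η ^ 2) / 2 := by
  unfold halfLog
  have hW2 : m ^ 2 ≤ W ^ 2 := by nlinarith [abs_nonneg W, sq_abs W]
  have hW2' : W ^ 2 ≤ M ^ 2 := by nlinarith [abs_nonneg W, sq_abs W]
  have hpos : 0 < W ^ 2 + η ^ 2 := by nlinarith [sq_nonneg η]
  have hup : Real.log (W ^ 2 + η ^ 2) ≤ Real.log (M ^ 2 + η ^ 2) := Real.log_le_log hpos (by nlinarith)
  have hlo : 2 * Real.log m ≤ Real.log (W ^ 2 + η ^ 2) := by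
    rw [show 2 * Real.log m = Real.log (m ^ 2) by rw [Real.log_pow]; push_cast; ring]
    exact Real.log_le_log (by positivity) (by nlinarith [sq_nonneg η])
  have hM0 : 0 ≤ Real.log (M ^ 2 + η ^ 2) := Real.log_nonneg (by nlinarith [sq_nonneg η])
  have habs : -|Real.log m| ≤ Real.log m := neg_abs_le _
  have habs' : 0 ≤ |Real.log m| := abs_nonneg _
  rw [abs_le]
  constructor <;> linarith

/-- **The primitive is Lipschitz in its endpoint** away from `0`: if `m ≤ |W| ≤ M` on the segment `[V, V']`
(`0 < m`, `1 ≤ M`, `η ≠ 0`), then `|prim η V' − prim η V| ≤ (|log m| + ½log(M²+η²))·|V' − V|`. -/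
theorem abs_prim_sub_prim_le {η : ℝ} (hη : η ≠ 0) {m M V V' : ℝ} (hm : 0 < m) (hM : 1 ≤ M)
    (hseg : ∀ W ∈ uIcc V V', m ≤ |W| ∧ |W| ≤ M) :
    |prim η V' - prim η V| ≤ (|Real.log m| + Real.log (M ^ 2 + η ^ 2) / 2) * |V' - V| := by
  have h := Convex.norm_image_sub_le_of_norm_hasDerivWithin_le (f := prim η) (f' := halfLog η) (s := uIcc V V')
    (fun W _ => (hasDerivAt_prim hη W).hasDerivWithinAt)
    (fun W hW => by rw [Real.norm_eq_abs]; exact abs_halfLog_le hm hM (hseg W hW).1 (hseg W hW).2)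
    (convex_uIcc V V') left_mem_uIcc right_mem_uIcc
  rwa [Real.norm_eq_abs, Real.norm_eq_abs] at h

end Summit.KontsevichZagierPeriods.Zeta5Search.TwoTaleLineBound

end
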